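import Literature.Computability.AlgebraicComplexity.ArithCircuitScaledBlocks
import Literature.Computability.AlgebraicComplexity.IMMInVPProofs
import Literature.Computability.AlgebraicComplexity.VNPClosedUnderComposition
import Literature.Computability.AlgebraicComplexity.BurgisserBooleanParts
import HarnessLib

/-!
# Degree truncation of a Valiant Boolean sum is a Valiant Boolean sum, with explicit bounds
# (the "standard homogenisation" step of Kumar–Ramya–Saptharishi–Tengse 2022, §3.5)

Topic `Computability/AlgebraicComplexity`. Cell `val-lit` (np corpus, row KRST2022-A, typer t21;
source `paper:arxiv-2012.07056` = Kumar–Ramya–Saptharishi–Tengse, *If VNP is hard, then so are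
equations for it*, STACS 2022; bib `KumarRamyaSaptharishiTengse2022`). The printed proof of the
Main Theorem (§3.5, held chunk p0008.txt:L42–43) uses, for a general degree parameter `d ≤ n`:

> Let `F^{≤d}_{n,n,p}(y, z)` denote the polynomial obtained from `F_{n,n,p}` by discarding all
> terms whose total degree in `y` exceeds `d`. By standard homogenisation arguments, it follows
> that `F^{≤d}_{n,n,p} ∈ VNP` as well.

This file proves that step ONCE, for every Valiant Boolean sum and with explicit size and degree
bookkeeping, in the tree's vocabulary (`boolSum`, `complexity`, `MvPolynomial.homogeneousComponent`):
if `f = Σ_{e ∈ {0,1}^u} g(x, e)` (`f = boolSum g`, `x = Fin n`) has total degree `≤ D` and the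
field has `D + 1` distinct elements `v₀, …, v_D`, then the degree-`≤ d` truncation
`f^{≤ d} = Σ_{i ≤ d} f^{(i)}` is the Boolean sum of the INTERPOLATION WITNESS
`W = Σ_j μ_j · g(v_j • x, e)`, `μ_j = Σ_{i ≤ d} (V⁻¹)_{i j}` (`V` the Vandermonde matrix of `v`):
the Boolean substitution `e ↦ {0,1}` commutes with rescaling the free variables `x`
(`boolSum_aeval_extend`), and `Σ_j (V⁻¹)_{i j} f(v_j • x) = f^{(i)}` is the tree's interpolation
identity `vandermonde_inv_sum_bind₁_eq_homogeneousComponent` (Strassen 1973; Bürgisser 2000, §2.1).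
Bounds: `L(W) ≤ (D + 1) · (L(g) + n + 2)` (each rescaled copy costs `L(g) + n`, one scalar
multiplication and one addition per node) and `deg W ≤ deg g`.

* `BoolSumTrunc.scaleX t` — the substitution `x_i ↦ t · x_i`, Boolean variables untouched;
  `BoolSumTrunc.boolSum_aeval_scaleX` — `Σ_e g(t • x, e) = f(t • x)`;
* `BoolSumTrunc.truncWeight D d v j = Σ_{i ≤ d} (V⁻¹)_{i j}`, `BoolSumTrunc.truncWitness D d v g = W`;
* `BoolSumTrunc.boolSum_truncWitness` — `boolSum W = Σ_{i ≤ d} (boolSum g)^{(i)}` (`d ≤ D`,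
  `deg (boolSum g) ≤ D`, `v` injective);
* `BoolSumTrunc.complexity_truncWitness_le`, `BoolSumTrunc.totalDegree_truncWitness_le`;
* `BoolSumTrunc.coeff_sum_homogeneousComponent_of_le` — the truncation keeps every coefficient of
  degree `≤ d` (so coefficient vectors on degree-`≤ d` monomials are unchanged);
* `BoolSumTrunc.exists_boolSum_eq_truncation` — packaged form: from `u ≤ t`, `L(g) ≤ t`,
  `deg g ≤ t`, `deg (boolSum g) ≤ D` and `D + 1` distinct field elements, a witness for
  `Σ_{i ≤ d} (boolSum g)^{(i)}` with `u ≤ t` Boolean variables, size `≤ (D+1)(t+n+2)`, degree `≤ t`;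
  `BoolSumTrunc.exists_boolSum_eq_truncation_charZero` — nodes `0, 1, …, D` in characteristic `0`.

The slice-level corollaries (`vnpSlice F n d t`, `SmallDefinable F n b` closed under degree
truncation) and the KRST Main Theorem for general `d ≤ n` are in
`Literature/Barriers/ValiantsHypothesis/KRST2022GeneralDegree.lean`.

Plumbing definitions with bodies; 0 named facts; theorems only. Honest framing: routine closure
bookkeeping of a published 2022 proof step; `VP ≠ VNP` is NOT proved and nothing here bears on it.

## References

* [KumarRamyaSaptharishiTengse2022] M. Kumar, C. Ramya, R. Saptharishi, A. Tengse, *If VNP is hard,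
  then so are equations for it*, STACS 2022, LIPIcs 219, 44 (arXiv:2012.07056), §3.5 (proof of the
  Main Theorem, the truncation `F^{≤d}_{n,n,p}`), held chunk p0008.txt:L42–43.
* [Burgisser2000] P. Bürgisser, *Completeness and Reduction in Algebraic Complexity Theory*,
  Springer 2000, §2.1 (homogeneous components by interpolation), Def. 2.5 (Boolean sums).
* [Strassen1973] V. Strassen, *Vermeidung von Divisionen*, J. reine angew. Math. 264 (1973)
  (interpolation of homogeneous parts) — cited through [Burgisser2000].
-/

noncomputable section

open MvPolynomial

namespace Literature.Computability.AlgebraicComplexity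

namespace BoolSumTrunc

variable {F : Type*} [Field F] {n u : ℕ}

/-! ### §1. Rescaling the free variables commutes with the Boolean sum -/

/-- The substitution `x_i ↦ t · x_i` on the free variables `x = Fin n` of a Boolean-sum witness,
leaving the summation variables `e = Fin u` untouched.
[cite: KumarRamyaSaptharishiTengse2022, §3.5 (proof of the Main Theorem, "standard homogenisation arguments")]
locator: paper:arxiv-2012.07056 chunk p0008.txt:L42–43 -/
def scaleX (t : F) : Fin n ⊕ Fin u → MvPolynomial (Fin n ⊕ Fin u) F :=
  Sum.elim (fun i => C t * X (Sum.inl i)) (fun j => X (Sum.inr j))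

/-- `scaleX t` is the "extend by the identity on the Boolean block" of the substitution
`x_i ↦ t · x_i` (the shape of `boolSum_aeval_extend`). [folklore] -/
private theorem scaleX_eq_extend (t : F) :
    (scaleX (n := n) (u := u) t) =
      Sum.elim (fun w : Fin n => rename Sum.inl (C t * X w : MvPolynomial (Fin n) F))
        (fun j => X (Sum.inr j)) := by
  funext v
  rcases v with i | j
  · simp [scaleX, rename_X, map_mul]
  · rfl

/-- **Rescaling commutes with the Boolean sum**: `Σ_{e ∈ {0,1}^u} g(t • x, e) = f(t • x)` for
`f = Σ_e g(x, e)`. [cite: Burgisser2000, Def. 2.5 (Boolean sums) and §2.1] -/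
theorem boolSum_aeval_scaleX (t : F) (g : MvPolynomial (Fin n ⊕ Fin u) F) :
    boolSum (aeval (scaleX t) g) = bind₁ (fun i : Fin n => C t * X i) (boolSum g) := by
  rw [scaleX_eq_extend, boolSum_aeval_extend]
  rfl

/-- The rescaled witness costs at most `n` extra gates (one product `t · x_i` per free variable).
[cite: Burgisser2000, §2.1] -/
theorem complexity_aeval_scaleX_le (t : F) (g : MvPolynomial (Fin n ⊕ Fin u) F) :
    complexity (aeval (scaleX t) g) ≤ complexity g + n := by
  refine (complexity_aeval_le g (scaleX t)).trans ?_
  rw [Fintype.sum_sum_type]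
  have h1 : ∑ i : Fin n, complexity (scaleX (n := n) (u := u) t (Sum.inl i)) ≤ n := by
    calc ∑ i : Fin n, complexity (scaleX (n := n) (u := u) t (Sum.inl i))
        ≤ ∑ _i : Fin n, 1 := by
          refine Finset.sum_le_sum fun i _ => ?_
          simp only [scaleX, Sum.elim_inl]
          calc complexity (C t * X (Sum.inl i) : MvPolynomial (Fin n ⊕ Fin u) F)
              ≤ complexity (C t : MvPolynomial (Fin n ⊕ Fin u) F) +
                  complexity (X (Sum.inl i) : MvPolynomial (Fin n ⊕ Fin u) F) + 1 :=
                complexity_mul_le_holds _ _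
            _ = 1 := by rw [complexity_C_holds, complexity_X_holds]
      _ = n := by simp
  have h2 : ∑ j : Fin u, complexity (scaleX (n := n) (u := u) t (Sum.inr j)) = 0 := by
    refine Finset.sum_eq_zero fun j _ => ?_
    simp only [scaleX, Sum.elim_inr]
    exact complexity_X_holds _
  omega

/-- The rescaled witness has degree `≤ deg g` (every substituted polynomial has degree `≤ 1`).
[cite: Burgisser2000, §2.1] -/
theorem totalDegree_aeval_scaleX_le (t : F) (g : MvPolynomial (Fin n ⊕ Fin u) F) :
    (aeval (scaleX t) g).totalDegree ≤ g.totalDegree := by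
  refine totalDegree_aeval_le_of_le_one _ (fun v => ?_) g
  rcases v with i | j
  · simp only [scaleX, Sum.elim_inl]
    calc (C t * X (Sum.inl i) : MvPolynomial (Fin n ⊕ Fin u) F).totalDegree
        ≤ (C t : MvPolynomial (Fin n ⊕ Fin u) F).totalDegree +
            (X (Sum.inl i) : MvPolynomial (Fin n ⊕ Fin u) F).totalDegree := totalDegree_mul _ _
      _ ≤ 0 + 1 := by
          gcongr
          · exact (totalDegree_C t).le
          · exact (isHomogeneous_X F (Sum.inl i : Fin n ⊕ Fin u)).totalDegree_le
      _ = 1 := rfl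
  · simp only [scaleX, Sum.elim_inr]
    exact (isHomogeneous_X F (Sum.inr j : Fin n ⊕ Fin u)).totalDegree_le

/-! ### §2. The interpolation witness of the degree-`≤ d` truncation -/

/-- The interpolation weight of the node `j`: `μ_j = Σ_{i ≤ d} (V⁻¹)_{i j}`, `V` the Vandermonde
matrix of the `D + 1` nodes `v` (the sum of the rows `i ≤ d` of `V⁻¹`, each row extracting the
`i`-th homogeneous component). [cite: Burgisser2000, §2.1 (interpolation of homogeneous components)] -/
def truncWeight (D d : ℕ) (v : Fin (D + 1) → F) (j : Fin (D + 1)) : F :=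
  ∑ i : Fin (D + 1), if (i : ℕ) ≤ d then (Matrix.vandermonde v)⁻¹ i j else 0

/-- **The truncation witness** `W = Σ_j μ_j · g(v_j • x, e)`: a polynomial in the same variables
`Fin n ⊕ Fin u` as `g` whose Boolean sum is the degree-`≤ d` truncation of `boolSum g`
(`boolSum_truncWitness`). This is the tree's rendering of KRST's `F^{≤d}` "obtained by discarding all
terms whose total degree in `y` exceeds `d`", shown to be in `VNP` "by standard homogenisation
arguments". [cite: KumarRamyaSaptharishiTengse2022, §3.5 (proof of the Main Theorem)]
locator: paper:arxiv-2012.07056 chunk p0008.txt:L42–43 -/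
def truncWitness (D d : ℕ) (v : Fin (D + 1) → F) (g : MvPolynomial (Fin n ⊕ Fin u) F) :
    MvPolynomial (Fin n ⊕ Fin u) F :=
  ∑ j : Fin (D + 1), truncWeight D d v j • aeval (scaleX (v j)) g

/-- The rows `i ≤ d` of `range (D + 1)` are `range (d + 1)` when `d ≤ D`. [folklore] -/
private theorem filter_le_range {D d : ℕ} (hd : d ≤ D) :
    (Finset.range (D + 1)).filter (fun i => i ≤ d) = Finset.range (d + 1) := by
  ext i
  simp only [Finset.mem_filter, Finset.mem_range]
  omega

/-- **The Boolean sum of the truncation witness is the truncation**: for `d ≤ D`, `D + 1` distinct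
nodes `v` and `deg (boolSum g) ≤ D`,
`Σ_{e ∈ {0,1}^u} W(x, e) = Σ_{i ≤ d} (Σ_e g(x, e))^{(i)}`.
Proof: the Boolean sum is linear and commutes with rescaling (`boolSum_aeval_scaleX`), and
`Σ_j (V⁻¹)_{i j} f(v_j • x) = f^{(i)}` (`vandermonde_inv_sum_bind₁_eq_homogeneousComponent`).
[cite: KumarRamyaSaptharishiTengse2022, §3.5 (proof of the Main Theorem, `F^{≤d}_{n,n,p} ∈ VNP`)]
locator: paper:arxiv-2012.07056 chunk p0008.txt:L42–43 -/
theorem boolSum_truncWitness {D d : ℕ} (hd : d ≤ D) {v : Fin (D + 1) → F}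
    (hv : Function.Injective v) (g : MvPolynomial (Fin n ⊕ Fin u) F)
    (hg : (boolSum g).totalDegree ≤ D) :
    boolSum (truncWitness D d v g) =
      ∑ i ∈ Finset.range (d + 1), homogeneousComponent i (boolSum g) := by
  set f := boolSum g with hf
  have hlin : boolSum (truncWitness D d v g) =
      ∑ j : Fin (D + 1), truncWeight D d v j • bind₁ (fun i : Fin n => C (v j) * X i) f := by
    unfold truncWitness
    rw [boolSum_finset_sum]
    refine Finset.sum_congr rfl fun j _ => ?_
    rw [smul_eq_C_mul, VNPSum.boolSum_C_mul, boolSum_aeval_scaleX, ← smul_eq_C_mul]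
  rw [hlin]
  simp_rw [truncWeight, Finset.sum_smul, ite_smul, zero_smul]
  rw [Finset.sum_comm]
  have hrow : ∀ i : Fin (D + 1),
      ∑ j : Fin (D + 1), (if (i : ℕ) ≤ d then (Matrix.vandermonde v)⁻¹ i j • bind₁
          (fun x : Fin n => C (v j) * X x) f else 0) =
        if (i : ℕ) ≤ d then homogeneousComponent i f else 0 := by
    intro i
    split_ifs with hi
    · have h := vandermonde_inv_sum_bind₁_eq_homogeneousComponent D i i.isLt f hg v hv
      exact h
    · simp
  simp_rw [hrow]
  rw [Fin.sum_univ_eq_sum_range (fun i => if i ≤ d then homogeneousComponent i f else 0) (D + 1),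
    ← Finset.sum_filter, filter_le_range hd]

/-- **Size of the truncation witness**: `L(W) ≤ (D + 1) · (L(g) + n + 2)` — `D + 1` rescaled copies
of `g` (`L(g) + n` each), one scalar multiplication and one addition per copy.
[cite: Burgisser2000, §2.1 (cost of interpolation)] -/
theorem complexity_truncWitness_le (D d : ℕ) (v : Fin (D + 1) → F)
    (g : MvPolynomial (Fin n ⊕ Fin u) F) :
    complexity (truncWitness D d v g) ≤ (D + 1) * (complexity g + n + 2) := by
  unfold truncWitness
  refine (complexity_finset_sum_le _ _).trans ?_
  rw [Finset.card_univ, Fintype.card_fin]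
  have h : ∀ j : Fin (D + 1),
      complexity (truncWeight D d v j • aeval (scaleX (v j)) g) ≤ complexity g + n + 1 := fun j =>
    calc complexity (truncWeight D d v j • aeval (scaleX (v j)) g)
        ≤ complexity (aeval (scaleX (v j)) g) + 1 := complexity_smul_le_holds _ _
      _ ≤ complexity g + n + 1 := by
          have := complexity_aeval_scaleX_le (v j) g
          omega
  calc ∑ j : Fin (D + 1), complexity (truncWeight D d v j • aeval (scaleX (v j)) g) + (D + 1)
      ≤ ∑ _j : Fin (D + 1), (complexity g + n + 1) + (D + 1) := by
        gcongr with j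
        exact h j
    _ = (D + 1) * (complexity g + n + 2) := by
        rw [Finset.sum_const, Finset.card_univ, Fintype.card_fin, smul_eq_mul]
        ring

/-- **Degree of the truncation witness**: `deg W ≤ deg g`.
[cite: Burgisser2000, §2.1] -/
theorem totalDegree_truncWitness_le (D d : ℕ) (v : Fin (D + 1) → F)
    (g : MvPolynomial (Fin n ⊕ Fin u) F) :
    (truncWitness D d v g).totalDegree ≤ g.totalDegree := by
  unfold truncWitness
  refine totalDegree_finsetSum_le fun j _ => ?_
  exact (totalDegree_smul_le _ _).trans (totalDegree_aeval_scaleX_le (v j) g)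

/-! ### §3. The truncation keeps the low-degree coefficients and has degree `≤ d` -/

/-- The degree-`≤ d` truncation `Σ_{i ≤ d} f^{(i)}` has the same coefficient as `f` at every
monomial of degree `≤ d`. [cite: Burgisser2000, §2.1] -/
theorem coeff_sum_homogeneousComponent_of_le {σ : Type*} {R : Type*} [CommSemiring R]
    (f : MvPolynomial σ R) {d : ℕ} {m : σ →₀ ℕ} (hm : m.degree ≤ d) :
    coeff m (∑ i ∈ Finset.range (d + 1), homogeneousComponent i f) = coeff m f := by
  rw [coeff_sum]
  simp_rw [coeff_homogeneousComponent]
  rw [Finset.sum_ite_eq, if_pos (Finset.mem_range.mpr (Nat.lt_succ_of_le hm))]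

/-- The degree-`≤ d` truncation vanishes at every monomial of degree `> d`.
[cite: Burgisser2000, §2.1] -/
theorem coeff_sum_homogeneousComponent_of_lt {σ : Type*} {R : Type*} [CommSemiring R]
    (f : MvPolynomial σ R) {d : ℕ} {m : σ →₀ ℕ} (hm : d < m.degree) :
    coeff m (∑ i ∈ Finset.range (d + 1), homogeneousComponent i f) = 0 := by
  rw [coeff_sum]
  refine Finset.sum_eq_zero fun i hi => ?_
  rw [coeff_homogeneousComponent, if_neg]
  have := Finset.mem_range.mp hi
  omega

/-- The degree-`≤ d` truncation has total degree `≤ d`. [cite: Burgisser2000, §2.1] -/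
theorem totalDegree_sum_homogeneousComponent_le {σ : Type*} {R : Type*} [CommSemiring R]
    (f : MvPolynomial σ R) (d : ℕ) :
    (∑ i ∈ Finset.range (d + 1), homogeneousComponent i f).totalDegree ≤ d := by
  refine totalDegree_finsetSum_le fun i hi => ?_
  have hi' : i ≤ d := Nat.lt_succ_iff.mp (Finset.mem_range.mp hi)
  exact (homogeneousComponent_isHomogeneous i f).totalDegree_le.trans hi'

/-- The degree-`≤ d` truncation of a polynomial of degree `≤ d` is the polynomial itself.
[cite: Burgisser2000, §2.1] -/
theorem sum_homogeneousComponent_of_totalDegree_le {σ : Type*} {R : Type*} [CommSemiring R]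
    (f : MvPolynomial σ R) {d : ℕ} (hf : f.totalDegree ≤ d) :
    ∑ i ∈ Finset.range (d + 1), homogeneousComponent i f = f := by
  conv_rhs => rw [← sum_homogeneousComponent f]
  symm
  apply Finset.sum_subset
  · exact Finset.range_subset_range.mpr (by omega)
  · intro i _ hi
    apply homogeneousComponent_eq_zero
    simp only [Finset.mem_range, not_lt] at hi
    omega

/-! ### §4. Packaged: the truncation of a Boolean sum is a Boolean sum with explicit bounds -/

/-- **Degree truncation inside Valiant's Boolean sums, with bounds** (the "standard
homogenisation" step of KRST §3.5, explicit): if `g` has `u ≤ t` Boolean variables, size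
`L(g) ≤ t` and degree `≤ t`, `deg (boolSum g) ≤ D`, `d ≤ D`, and the field contains `D + 1`
distinct elements, then `Σ_{i ≤ d} (boolSum g)^{(i)} = boolSum W` for a `W` in the same variables
with `L(W) ≤ (D + 1) · (t + n + 2)` and `deg W ≤ t`.
[cite: KumarRamyaSaptharishiTengse2022, §3.5 (proof of the Main Theorem, `F^{≤d}_{n,n,p} ∈ VNP`)]
locator: paper:arxiv-2012.07056 chunk p0008.txt:L42–43 -/
theorem exists_boolSum_eq_truncation {D d t : ℕ} (hd : d ≤ D) {v : Fin (D + 1) → F}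
    (hv : Function.Injective v) (g : MvPolynomial (Fin n ⊕ Fin u) F)
    (hgc : complexity g ≤ t) (hgd : g.totalDegree ≤ t) (hD : (boolSum g).totalDegree ≤ D) :
    ∃ W : MvPolynomial (Fin n ⊕ Fin u) F,
      complexity W ≤ (D + 1) * (t + n + 2) ∧ W.totalDegree ≤ t ∧
        ∑ i ∈ Finset.range (d + 1), homogeneousComponent i (boolSum g) = boolSum W := by
  refine ⟨truncWitness D d v g, ?_, (totalDegree_truncWitness_le D d v g).trans hgd,
    (boolSum_truncWitness hd hv g hD).symm⟩
  calc complexity (truncWitness D d v g) ≤ (D + 1) * (complexity g + n + 2) :=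
        complexity_truncWitness_le D d v g
    _ ≤ (D + 1) * (t + n + 2) := by gcongr

/-- The nodes `0, 1, …, D` are distinct in characteristic zero. [folklore] -/
private theorem natCast_fin_injective [CharZero F] (D : ℕ) :
    Function.Injective (fun j : Fin (D + 1) => ((j : ℕ) : F)) := by
  intro a b h
  have h' : ((a : ℕ) : F) = ((b : ℕ) : F) := h
  exact Fin.ext (Nat.cast_injective h')

/-- **Characteristic zero**: the same with the nodes `0, 1, …, D` (KRST's setting: `ℂ`, "any field
of characteristic zero", Remark after the Main Theorem).
[cite: KumarRamyaSaptharishiTengse2022, §3.5 (proof of the Main Theorem) and Remark 1]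
locator: paper:arxiv-2012.07056 chunk p0008.txt:L42–43, p0004.txt:L1–2 -/
theorem exists_boolSum_eq_truncation_charZero [CharZero F] {D d t : ℕ} (hd : d ≤ D)
    (g : MvPolynomial (Fin n ⊕ Fin u) F)
    (hgc : complexity g ≤ t) (hgd : g.totalDegree ≤ t) (hD : (boolSum g).totalDegree ≤ D) :
    ∃ W : MvPolynomial (Fin n ⊕ Fin u) F,
      complexity W ≤ (D + 1) * (t + n + 2) ∧ W.totalDegree ≤ t ∧
        ∑ i ∈ Finset.range (d + 1), homogeneousComponent i (boolSum g) = boolSum W :=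
  exists_boolSum_eq_truncation hd (natCast_fin_injective D) g hgc hgd hD

end BoolSumTrunc

end Literature.Computability.AlgebraicComplexity

end
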